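import Mathlib.Analysis.Calculus.Taylor
import Mathlib.Analysis.SpecialFunctions.Log.Deriv
import Mathlib.MeasureTheory.Integral.IntegralEqImproper
import HarnessLib

/-!
# The excursion-kernel identity `−log Φ'(0) = ∬_{(−∞,0)²} [(x−y)⁻² − Φ'(x)Φ'(y)(Φ(x)−Φ(y))⁻²] dx dy`

Topic `Probability/RandomPlanarGeometry` (support for the one-sided restriction measures of
Lawler–Schramm–Werner, *Conformal restriction: the chordal case*, J. Amer. Math. Soc. **16**
(2003), §8; arXiv:math/0209343). A pure real-analysis identity, used (in a sibling file) to
compute the avoidance probabilities of the Poisson cloud of conformal images of two-sided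
restriction samples which realizes the right-sided restriction measure `P⁺_β` for every `β > 0`.

Let `φ : ℝ → ℝ` be `C²` on `(−∞, ε)` for some `ε > 0`, with `φ(0) = 0`, `φ' > 0` and
`φ(x)/x → 1` as `x → −∞` (the trace on `(−∞, 0]` of the boundary extension of the restriction
map `Φ_A` of a hull `A` attached to `(0, ∞)`), and put

  `g(x, y) = (x − y)⁻² − φ'(x) φ'(y) (φ(x) − φ(y))⁻²`   (`x ≠ y`),

the difference of the boundary Poisson kernels `H_ℍ(x, y) = (x − y)⁻²` of `ℍ` and
`H_{ℍ∖A}(x, y) = Φ'(x)Φ'(y) H_ℍ(Φ(x), Φ(y))` of `ℍ ∖ A`, i.e. the (normalized) mass of Brownian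
excursions from `x` to `y` hitting `A`. Assume `g ≥ 0` off the diagonal (in the application this
is `P[excursion hits A] ≥ 0`). Then

* `integral_Iio_excursionKernel` — for every `x < 0`, `y ↦ g(x, y)` is integrable on `(−∞, 0)`
  and `∫_{−∞}^0 g(x, y) dy = 1/x − φ'(x)/φ(x)`: the antiderivative
  `G_x(y) = (x − y)⁻¹ − φ'(x)/(φ(x) − φ(y))` has a removable singularity at `y = x` (value
  `−φ''(x)/(2φ'(x))`, by the second-order Taylor expansion of `φ` at `x`), tends to `0` at `−∞`
  and to `1/x − φ'(x)/φ(x)` at `0⁻`;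
* `integral_Iio_inv_sub_deriv_div` — `x ↦ 1/x − φ'(x)/φ(x) = (log (x/φ(x)))'` is integrable on
  `(−∞, 0)` with integral `−log φ'(0)` (`x/φ(x) → 1` at `−∞`, `→ 1/φ'(0)` at `0⁻`);
* `lintegral_lintegral_excursionKernel` — hence
  **`∫⁻_{x<0} ∫⁻_{y<0} g(x, y) = −log φ'(0)`** (as extended nonnegative reals), and the real
  iterated form `integral_integral_excursionKernel`.

(So the measure `(x − y)⁻² dx dy ⊗ (excursion from x to y)` gives the event "hits `A`" the mass
`−log Φ_A'(0)`, which is additive under the composition of hulls, as is `−log Φ'_A(0)`; this is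
the Lévy measure of the semigroup `(P⁺_β)_{β>0}` of [LSW] §8.2. The identity itself is
elementary calculus and is recorded as folklore.)

Mathlib: `Real.taylor_tendsto`, `intervalIntegral.integral_eq_sub_of_hasDerivAt_of_le`,
`intervalIntegral.integrableOn_deriv_of_nonneg`, `MeasureTheory.integral_Iic_of_hasDerivAt_of_tendsto`,
`MeasureTheory.ofReal_integral_eq_lintegral_ofReal`.
-/

noncomputable section

open Set Filter MeasureTheory Topology
open scoped ENNReal

namespace Literature.Probability.RandomPlanarGeometry

namespace ExcursionKernel

variable {φ : ℝ → ℝ} {ε : ℝ}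

/-! ### Preliminaries on `φ` -/

/-- `φ` is differentiable on the open set `(−∞, ε)`. [folklore] -/
theorem hasDerivAt (hφ : ContDiffOn ℝ 2 φ (Iio ε)) {x : ℝ} (hx : x < ε) :
    HasDerivAt φ (deriv φ x) x :=
  ((hφ.differentiableOn (by norm_num)).differentiableAt (Iio_mem_nhds hx)).hasDerivAt

/-- `φ'` is continuously differentiable on `(−∞, ε)`. [folklore] -/
theorem contDiffOn_deriv (hφ : ContDiffOn ℝ 2 φ (Iio ε)) : ContDiffOn ℝ 1 (deriv φ) (Iio ε) :=
  hφ.deriv_of_isOpen isOpen_Iio (by norm_num)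

/-- `φ'` is differentiable on `(−∞, ε)`. [folklore] -/
theorem hasDerivAt_deriv (hφ : ContDiffOn ℝ 2 φ (Iio ε)) {x : ℝ} (hx : x < ε) :
    HasDerivAt (deriv φ) (deriv (deriv φ) x) x :=
  (((contDiffOn_deriv hφ).differentiableOn one_ne_zero).differentiableAt (Iio_mem_nhds hx)).hasDerivAt

/-- `φ` is continuous on `(−∞, ε)`. [folklore] -/
theorem continuousOn (hφ : ContDiffOn ℝ 2 φ (Iio ε)) : ContinuousOn φ (Iio ε) :=
  hφ.continuousOn

/-- `φ'` is continuous on `(−∞, ε)`. [folklore] -/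
theorem continuousOn_deriv (hφ : ContDiffOn ℝ 2 φ (Iio ε)) : ContinuousOn (deriv φ) (Iio ε) :=
  hφ.continuousOn_deriv_of_isOpen isOpen_Iio (by norm_num)

/-- `φ` is strictly increasing on `(−∞, ε)`. [folklore] -/
theorem strictMonoOn (hφ : ContDiffOn ℝ 2 φ (Iio ε)) (hpos : ∀ x, x < ε → 0 < deriv φ x) :
    StrictMonoOn φ (Iio ε) :=
  strictMonoOn_of_deriv_pos (convex_Iio ε) (continuousOn hφ) fun x hx ↦
    hpos x (by simpa [interior_Iio] using hx)

/-- `φ < 0` on `(−∞, 0)` (as `φ(0) = 0`). [folklore] -/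
theorem neg_of_neg (hε : 0 < ε) (hφ : ContDiffOn ℝ 2 φ (Iio ε))
    (hpos : ∀ x, x < ε → 0 < deriv φ x) (hφ0 : φ 0 = 0) {x : ℝ} (hx : x < 0) : φ x < 0 := by
  simpa [hφ0] using strictMonoOn hφ hpos (hx.trans hε) hε hx

/-- `φ x ≠ φ y` for `x ≠ y` in `(−∞, ε)`. [folklore] -/
theorem apply_ne_apply (hφ : ContDiffOn ℝ 2 φ (Iio ε)) (hpos : ∀ x, x < ε → 0 < deriv φ x)
    {x y : ℝ} (hx : x < ε) (hy : y < ε) (hxy : x ≠ y) : φ x ≠ φ y :=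
  ((strictMonoOn hφ hpos).injOn.ne_iff hx hy).2 hxy

/-- `φ(y) → −∞` as `y → −∞` (from `φ(y)/y → 1`). [folklore] -/
theorem tendsto_atBot (hlim : Tendsto (fun x ↦ φ x / x) atBot (𝓝 1)) : Tendsto φ atBot atBot := by
  have h : Tendsto (fun x ↦ φ x / x * x) atBot atBot :=
    Tendsto.pos_mul_atBot one_pos hlim tendsto_id
  refine h.congr' ?_
  filter_upwards [eventually_lt_atBot (0 : ℝ)] with x hx
  field_simp [hx.ne]

/-- `φ(x)/x → φ'(0)` as `x → 0`, `x ≠ 0` (`φ(0) = 0`). [folklore] -/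
theorem tendsto_div_nhds_zero (hε : 0 < ε) (hφ : ContDiffOn ℝ 2 φ (Iio ε)) (hφ0 : φ 0 = 0) :
    Tendsto (fun x ↦ φ x / x) (𝓝[≠] 0) (𝓝 (deriv φ 0)) := by
  -- `slope φ 0 x = (x - 0)⁻¹ • (φ x - φ 0) = φ x / x`
  have h' : Tendsto (slope φ 0) (𝓝[≠] 0) (𝓝 (deriv φ 0)) :=
    hasDerivAt_iff_tendsto_slope.1 (hasDerivAt hφ hε)
  refine h'.congr' ?_
  filter_upwards [self_mem_nhdsWithin] with x hx
  simp [slope_def_field, hφ0, div_eq_inv_mul]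

/-! ### The antiderivative `G_x(y) = (x − y)⁻¹ − φ'(x)/(φ(x) − φ(y))` in `y` -/

/-- **`∂_y G_x = g(x, ·)` off the diagonal**: for `y < ε`, `y ≠ x`,
`d/dy [(x − y)⁻¹ − φ'(x)/(φ(x) − φ(y))] = (x − y)⁻² − φ'(x)φ'(y)/(φ(x) − φ(y))²`. [folklore] -/
theorem hasDerivAt_G (hφ : ContDiffOn ℝ 2 φ (Iio ε)) (hpos : ∀ x, x < ε → 0 < deriv φ x)
    {x y : ℝ} (hx : x < ε) (hy : y < ε) (hxy : y ≠ x) :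
    HasDerivAt (fun y ↦ (x - y)⁻¹ - deriv φ x / (φ x - φ y))
      (((x - y) ^ 2)⁻¹ - deriv φ x * deriv φ y / (φ x - φ y) ^ 2) y := by
  have hxy' : x - y ≠ 0 := sub_ne_zero.2 (Ne.symm hxy)
  have hφxy : φ x - φ y ≠ 0 := sub_ne_zero.2 (apply_ne_apply hφ hpos hx hy (Ne.symm hxy))
  have h1 : HasDerivAt (fun y ↦ (x - y)⁻¹) (((x - y) ^ 2)⁻¹) y := by
    have h := ((hasDerivAt_id' y).const_sub x).inv hxy'
    refine h.congr_deriv ?_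
    field_simp
  have h2 : HasDerivAt (fun y ↦ deriv φ x / (φ x - φ y))
      (deriv φ x * deriv φ y / (φ x - φ y) ^ 2) y := by
    have h := ((hasDerivAt hφ hy).const_sub (φ x)).inv hφxy
    have h' : HasDerivAt (fun y ↦ deriv φ x * (φ x - φ y)⁻¹)
        (deriv φ x * (-(-deriv φ y) / (φ x - φ y) ^ 2)) y := h.const_mul (deriv φ x)
    have h'' : HasDerivAt (fun y ↦ deriv φ x / (φ x - φ y))
        (deriv φ x * (-(-deriv φ y) / (φ x - φ y) ^ 2)) y :=
      h'.congr_of_eventuallyEq (Eventually.of_forall fun y ↦ by simp [div_eq_mul_inv])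
    refine h''.congr_deriv ?_
    field_simp
  exact h1.sub h2

/-- `G_x(y) → 0` as `y → −∞` (`φ(y) → −∞`). [folklore] -/
theorem tendsto_G_atBot (hlim : Tendsto (fun x ↦ φ x / x) atBot (𝓝 1)) (x : ℝ) :
    Tendsto (fun y ↦ (x - y)⁻¹ - deriv φ x / (φ x - φ y)) atBot (𝓝 0) := by
  have h1 : Tendsto (fun y ↦ (x - y)⁻¹) atBot (𝓝 0) := by
    have h : Tendsto (fun y ↦ x - y) atBot atTop := tendsto_atTop_add_const_left _ _ tendsto_neg_atBot_atTop
    exact h.inv_tendsto_atTop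
  have h2 : Tendsto (fun y ↦ deriv φ x / (φ x - φ y)) atBot (𝓝 0) := by
    have h : Tendsto (fun y ↦ φ x - φ y) atBot atTop :=
      tendsto_atTop_add_const_left _ _ (tendsto_neg_atBot_atTop.comp (tendsto_atBot hlim))
    simpa [div_eq_mul_inv] using h.inv_tendsto_atTop.const_mul (deriv φ x)
  simpa using h1.sub h2

/-- **The removable singularity of `G_x` at `y = x`**: `G_x(y) → −φ''(x)/(2φ'(x))` as `y → x`,
`y ≠ x`. Writing `h = y − x`, `Δ = φ(y) − φ(x)`,
`G_x(y) = −[(Δ − φ'(x)h)/h²]/(Δ/h)`, and `(Δ − φ'(x)h)/h² → φ''(x)/2` (Taylor), `Δ/h → φ'(x)`.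
[folklore] -/
theorem tendsto_G_diag (hφ : ContDiffOn ℝ 2 φ (Iio ε)) (hpos : ∀ x, x < ε → 0 < deriv φ x)
    {x : ℝ} (hx : x < ε) :
    Tendsto (fun y ↦ (x - y)⁻¹ - deriv φ x / (φ x - φ y)) (𝓝[≠] x)
      (𝓝 (-(deriv (deriv φ) x / 2) / deriv φ x)) := by
  -- the Taylor polynomial of order two at `x`
  have hT_eq : ∀ y, taylorWithinEval φ 2 (Iio ε) x y =
      φ x + deriv φ x * (y - x) + deriv (deriv φ) x / 2 * (y - x) ^ 2 := by
    intro y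
    have h1 : iteratedDerivWithin 1 φ (Iio ε) x = deriv φ x := by
      rw [iteratedDerivWithin_of_isOpen isOpen_Iio hx, iteratedDeriv_one]
    have h2 : iteratedDerivWithin 2 φ (Iio ε) x = deriv (deriv φ) x := by
      rw [iteratedDerivWithin_of_isOpen isOpen_Iio hx]
      rw [show iteratedDeriv 2 φ = deriv (iteratedDeriv 1 φ) from iteratedDeriv_succ, iteratedDeriv_one]
    simp only [taylor_within_apply, Finset.sum_range_succ, Finset.sum_range_zero, zero_add,
      iteratedDerivWithin_zero, pow_zero, pow_one, Nat.factorial_zero, Nat.factorial_one,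
      Nat.factorial_two, Nat.cast_one, Nat.cast_ofNat, inv_one, one_mul, mul_one, smul_eq_mul, h1, h2]
    ring
  -- Taylor: `(φ y − T y)/(y − x)² → 0` as `y → x`
  have hT : Tendsto (fun y ↦ (φ y - taylorWithinEval φ 2 (Iio ε) x y) / (y - x) ^ 2) (𝓝[≠] x) (𝓝 0) := by
    have h := Real.taylor_tendsto (convex_Iio ε) hx hφ (n := 2)
    rw [isOpen_Iio.nhdsWithin_eq hx] at h
    exact h.mono_left nhdsWithin_le_nhds
  -- numerator: `(φ y − φ x − φ'(x)(y − x))/(y − x)² → φ''(x)/2`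
  have hN : Tendsto (fun y ↦ (φ y - φ x - deriv φ x * (y - x)) / (y - x) ^ 2) (𝓝[≠] x)
      (𝓝 (deriv (deriv φ) x / 2)) := by
    have h := hT.add_const (deriv (deriv φ) x / 2)
    rw [zero_add] at h
    refine h.congr' ?_
    filter_upwards [self_mem_nhdsWithin] with y hy
    have hyx : (y - x) ^ 2 ≠ 0 := pow_ne_zero 2 (sub_ne_zero.2 hy)
    rw [hT_eq, div_add' _ _ _ hyx]
    congr 1
    ring
  -- denominator: the slope `(φ y − φ x)/(y − x) → φ'(x)`
  have hD : Tendsto (fun y ↦ (φ y - φ x) / (y - x)) (𝓝[≠] x) (𝓝 (deriv φ x)) := by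
    have h := hasDerivAt_iff_tendsto_slope.1 (hasDerivAt hφ hx)
    refine h.congr' ?_
    filter_upwards [self_mem_nhdsWithin] with y hy
    simp [slope_def_field]
  have hφ' : deriv φ x ≠ 0 := (hpos x hx).ne'
  have hlim := (hN.div hD hφ').neg
  refine (hlim.congr' ?_).trans (by rw [neg_div])
  -- the algebraic identity `G_x(y) = −N(y)/D(y)` for `y ≠ x` in `(−∞, ε)`
  filter_upwards [self_mem_nhdsWithin, mem_nhdsWithin_of_mem_nhds (Iio_mem_nhds hx)] with y hy hyε
  have hyx : y - x ≠ 0 := sub_ne_zero.2 hy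
  have hxy : x - y ≠ 0 := sub_ne_zero.2 (Ne.symm hy)
  have hφxy : φ x - φ y ≠ 0 := sub_ne_zero.2 (apply_ne_apply hφ hpos hx hyε (Ne.symm hy))
  have hφyx : φ y - φ x ≠ 0 := sub_ne_zero.2 (apply_ne_apply hφ hpos hyε hx hy)
  simp only [Pi.div_apply]
  field_simp
  ring

/-! ### The continuous extension `G̃_x` of `G_x` across the diagonal -/

/-- Away from `x`, the function `G_x` updated at `x` agrees with `G_x` near every `y ≠ x`.
[folklore] -/
theorem update_G_eventuallyEq {x y : ℝ} (hyx : y ≠ x) (v : ℝ) :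
    Function.update (fun y ↦ (x - y)⁻¹ - deriv φ x / (φ x - φ y)) x v =ᶠ[𝓝 y]
      fun y ↦ (x - y)⁻¹ - deriv φ x / (φ x - φ y) := by
  filter_upwards [isOpen_ne.mem_nhds hyx] with z hz
  exact Function.update_of_ne hz _ _

/-- **`G̃_x` is continuous on `(−∞, ε)`** (at `x` by the removable singularity
`tendsto_G_diag`, elsewhere because `G_x` is differentiable). [folklore] -/
theorem continuousAt_update_G (hφ : ContDiffOn ℝ 2 φ (Iio ε)) (hpos : ∀ x, x < ε → 0 < deriv φ x)
    {x y : ℝ} (hx : x < ε) (hy : y < ε) :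
    ContinuousAt (Function.update (fun y ↦ (x - y)⁻¹ - deriv φ x / (φ x - φ y)) x
      (-(deriv (deriv φ) x / 2) / deriv φ x)) y := by
  by_cases hyx : y = x
  · subst hyx
    rw [continuousAt_update_same]
    exact tendsto_G_diag hφ hpos hx
  · exact (hasDerivAt_G hφ hpos hx hy hyx).continuousAt.congr (update_G_eventuallyEq hyx _).symm

/-- `G̃_x` has derivative `g(x, ·)` off the diagonal. [folklore] -/
theorem hasDerivAt_update_G (hφ : ContDiffOn ℝ 2 φ (Iio ε)) (hpos : ∀ x, x < ε → 0 < deriv φ x)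
    {x y : ℝ} (hx : x < ε) (hy : y < ε) (hyx : y ≠ x) :
    HasDerivAt (Function.update (fun y ↦ (x - y)⁻¹ - deriv φ x / (φ x - φ y)) x
      (-(deriv (deriv φ) x / 2) / deriv φ x))
      (((x - y) ^ 2)⁻¹ - deriv φ x * deriv φ y / (φ x - φ y) ^ 2) y :=
  (hasDerivAt_G hφ hpos hx hy hyx).congr_of_eventuallyEq (update_G_eventuallyEq hyx _)

/-! ### Integrability of a nonnegative derivative on `(−∞, a]` -/

/-- **When a function has a limit at `−∞` and its derivative is nonnegative, the derivative is
integrable on `(−∞, a]`** (the mirror image of Mathlib's `integrableOn_Ioi_deriv_of_nonneg`).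
[folklore] -/
theorem integrableOn_Iic_deriv_of_nonneg {f f' : ℝ → ℝ} {a l : ℝ}
    (hcont : ContinuousWithinAt f (Iic a) a) (hderiv : ∀ x ∈ Iio a, HasDerivAt f (f' x) x)
    (f'pos : ∀ x ∈ Iic a, 0 ≤ f' x) (hf : Tendsto f atBot (𝓝 l)) : IntegrableOn f' (Iic a) := by
  have hcont' : ContinuousOn f (Iic a) := by
    intro x hx
    rcases hx.out.eq_or_lt with rfl | hx
    · exact hcont
    · exact (hderiv x hx).continuousAt.continuousWithinAt
  have hioc : ∀ i ≤ a, IntegrableOn f' (Ioc i a) := fun i hi ↦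
    intervalIntegral.integrableOn_deriv_of_nonneg (hcont'.mono Icc_subset_Iic_self)
      (fun y hy ↦ hderiv y hy.2) fun y hy ↦ f'pos y hy.2.le
  refine integrableOn_Iic_of_intervalIntegral_norm_tendsto (f a - l) a (fun i ↦ ?_) tendsto_id ?_
  · show IntegrableOn f' (Ioc i a) volume
    rcases le_or_gt i a with hia | hia
    · exact hioc i hia
    · rw [Ioc_eq_empty (not_lt.2 hia.le)]
      exact integrableOn_empty
  apply Tendsto.congr' _ (hf.const_sub _)
  filter_upwards [Iic_mem_atBot a] with i hi
  have hi' : id i ≤ a := hi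
  calc f a - f i = ∫ y in id i..a, f' y := by
        symm
        apply intervalIntegral.integral_eq_sub_of_hasDerivAt_of_le hi'
          (hcont'.mono Icc_subset_Iic_self) fun y hy ↦ hderiv y hy.2
        rw [intervalIntegrable_iff_integrableOn_Ioc_of_le hi']
        exact hioc i hi
    _ = ∫ y in id i..a, ‖f' y‖ := by
        simp_rw [intervalIntegral.integral_of_le hi']
        refine setIntegral_congr_fun measurableSet_Ioc fun y hy ↦ ?_
        rw [Real.norm_of_nonneg (f'pos _ hy.2)]

/-! ### The inner integral `∫_{−∞}^0 g(x, y) dy = 1/x − φ'(x)/φ(x)` -/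

/-- **The inner integral.** For `x < 0`, `y ↦ g(x, y) = (x − y)⁻² − φ'(x)φ'(y)/(φ(x) − φ(y))²`
is integrable on `(−∞, 0)` with `∫_{−∞}^0 g(x, y) dy = 1/x − φ'(x)/φ(x)`, provided `g(x, ·) ≥ 0`
off the diagonal: `g(x, ·) = G̃_x'`, `G̃_x(−∞) = 0`, `G̃_x(0) = 1/x − φ'(x)/φ(x)`. [folklore] -/
theorem integral_Iio_excursionKernel (hε : 0 < ε) (hφ : ContDiffOn ℝ 2 φ (Iio ε)) (hφ0 : φ 0 = 0)
    (hpos : ∀ x, x < ε → 0 < deriv φ x) (hlim : Tendsto (fun x ↦ φ x / x) atBot (𝓝 1))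
    {x : ℝ} (hx : x < 0)
    (hg : ∀ y, y < 0 → y ≠ x → 0 ≤ ((x - y) ^ 2)⁻¹ - deriv φ x * deriv φ y / (φ x - φ y) ^ 2) :
    IntegrableOn (fun y ↦ ((x - y) ^ 2)⁻¹ - deriv φ x * deriv φ y / (φ x - φ y) ^ 2) (Iio 0) ∧
      ∫ y in Iio 0, (((x - y) ^ 2)⁻¹ - deriv φ x * deriv φ y / (φ x - φ y) ^ 2) =
        x⁻¹ - deriv φ x / φ x := by
  have hxε : x < ε := hx.trans hε
  set ℓ : ℝ := -(deriv (deriv φ) x / 2) / deriv φ x with hℓ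
  set G : ℝ → ℝ := Function.update (fun y ↦ (x - y)⁻¹ - deriv φ x / (φ x - φ y)) x ℓ with hGdef
  set g : ℝ → ℝ := fun y ↦ ((x - y) ^ 2)⁻¹ - deriv φ x * deriv φ y / (φ x - φ y) ^ 2 with hgdef
  have hGx : G x = ℓ := by simp [hGdef]
  have hG0 : G 0 = x⁻¹ - deriv φ x / φ x := by
    rw [hGdef, Function.update_of_ne hx.ne']
    simp [hφ0]
  have hcontG : ∀ y, y < ε → ContinuousAt G y := fun y hy ↦ continuousAt_update_G hφ hpos hxε hy
  have hderivG : ∀ y, y < ε → y ≠ x → HasDerivAt G (g y) y := fun y hy hyx ↦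
    hasDerivAt_update_G hφ hpos hxε hy hyx
  have hg0 : ∀ y, y < 0 → 0 ≤ g y := by
    intro y hy
    rcases eq_or_ne y x with rfl | hyx
    · simp [hgdef]
    · exact hg y hy hyx
  -- on `(−∞, x]`
  have hGbot : Tendsto G atBot (𝓝 0) := by
    rw [hGdef]
    refine (tendsto_G_atBot hlim x).congr' ?_
    filter_upwards [eventually_lt_atBot x] with y hy
    exact (Function.update_of_ne hy.ne ℓ (fun y ↦ (x - y)⁻¹ - deriv φ x / (φ x - φ y))).symm
  have hint1 : IntegrableOn g (Iic x) :=
    integrableOn_Iic_deriv_of_nonneg (hcontG x hxε).continuousWithinAt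
      (fun y hy ↦ hderivG y ((mem_Iio.1 hy).trans hxε) (mem_Iio.1 hy).ne)
      (fun y hy ↦ hg0 y ((mem_Iic.1 hy).trans_lt hx)) hGbot
  have hI1 : ∫ y in Iic x, g y = ℓ := by
    rw [integral_Iic_of_hasDerivAt_of_tendsto (hcontG x hxε).continuousWithinAt
      (fun y hy ↦ hderivG y ((mem_Iio.1 hy).trans hxε) (mem_Iio.1 hy).ne) hint1 hGbot, hGx, sub_zero]
  -- on `[x, 0]`
  have hcont2 : ContinuousOn G (Icc x 0) := fun y hy ↦ (hcontG y (hy.2.trans_lt hε)).continuousWithinAt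
  have hderiv2 : ∀ y ∈ Ioo x 0, HasDerivAt G (g y) y := fun y hy ↦
    hderivG y (hy.2.trans hε) hy.1.ne'
  have hpos2 : ∀ y ∈ Ioo x 0, 0 ≤ g y := fun y hy ↦ hg y hy.2 hy.1.ne'
  have hint2 : IntegrableOn g (Ioc x 0) := intervalIntegral.integrableOn_deriv_of_nonneg hcont2 hderiv2 hpos2
  have hI2 : ∫ y in Ioc x 0, g y = x⁻¹ - deriv φ x / φ x - ℓ := by
    rw [← intervalIntegral.integral_of_le hx.le,
      intervalIntegral.integral_eq_sub_of_hasDerivAt_of_le hx.le hcont2 hderiv2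
        ((intervalIntegrable_iff_integrableOn_Ioc_of_le hx.le).2 hint2), hG0, hGx]
  -- assemble on `(−∞, 0) = (−∞, x] ∪ (x, 0]` (up to the null set `{0}`)
  have hunion : Iic x ∪ Ioc x 0 = Iic 0 := Iic_union_Ioc_eq_Iic hx.le
  have hint : IntegrableOn g (Iic 0) := hunion ▸ hint1.union hint2
  refine ⟨hint.mono_set Iio_subset_Iic_self, ?_⟩
  rw [← integral_Iic_eq_integral_Iio, ← hunion,
    setIntegral_union (Iic_disjoint_Ioc le_rfl) measurableSet_Ioc hint1 hint2, hI1, hI2]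
  ring

/-! ### The outer integral `∫_{−∞}^0 (1/x − φ'(x)/φ(x)) dx = −log φ'(0)` -/

/-- **The outer integral.** If `x ↦ 1/x − φ'(x)/φ(x)` is nonnegative on `(−∞, 0)`, then it is
integrable there with integral `−log φ'(0)`: it is the derivative of `log (x/φ(x))`, which tends
to `log 1 = 0` at `−∞` and to `log (1/φ'(0))` at `0⁻`. [folklore] -/
theorem integral_Iio_inv_sub_deriv_div (hε : 0 < ε) (hφ : ContDiffOn ℝ 2 φ (Iio ε)) (hφ0 : φ 0 = 0)
    (hpos : ∀ x, x < ε → 0 < deriv φ x) (hlim : Tendsto (fun x ↦ φ x / x) atBot (𝓝 1))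
    (hnn : ∀ x, x < 0 → 0 ≤ x⁻¹ - deriv φ x / φ x) :
    IntegrableOn (fun x ↦ x⁻¹ - deriv φ x / φ x) (Iio 0) ∧
      ∫ x in Iio 0, (x⁻¹ - deriv φ x / φ x) = -Real.log (deriv φ 0) := by
  set d : ℝ := deriv φ 0 with hd
  have hd0 : 0 < d := hpos 0 hε
  set F : ℝ → ℝ := fun x ↦ Real.log (x / φ x) with hFdef
  set Ft : ℝ → ℝ := Function.update F 0 (-Real.log d) with hFtdef
  -- derivative of `F` on `(−∞, 0)`
  have hderivF : ∀ x, x < 0 → HasDerivAt F (x⁻¹ - deriv φ x / φ x) x := by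
    intro x hx
    have hφx : φ x ≠ 0 := (neg_of_neg hε hφ hpos hφ0 hx).ne
    have h1 : HasDerivAt (fun x ↦ Real.log x - Real.log (φ x)) (x⁻¹ - deriv φ x / φ x) x :=
      (Real.hasDerivAt_log hx.ne).sub ((hasDerivAt hφ (hx.trans hε)).log hφx)
    refine h1.congr_of_eventuallyEq ?_
    filter_upwards [Iio_mem_nhds hx] with z hz
    exact Real.log_div hz.ne (neg_of_neg hε hφ hpos hφ0 hz).ne
  have hderivFt : ∀ x ∈ Iio 0, HasDerivAt Ft (x⁻¹ - deriv φ x / φ x) x := by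
    intro x hx
    refine (hderivF x hx).congr_of_eventuallyEq ?_
    filter_upwards [isOpen_ne.mem_nhds (mem_Iio.1 hx).ne] with z hz
    exact Function.update_of_ne hz _ _
  -- `x/φ(x) = (φ(x)/x)⁻¹`
  have hinv : ∀ x, x / φ x = (φ x / x)⁻¹ := fun x ↦ (inv_div _ _).symm
  -- limit at `−∞`
  have hFbot : Tendsto F atBot (𝓝 0) := by
    have h : Tendsto (fun x ↦ Real.log ((φ x / x)⁻¹)) atBot (𝓝 (Real.log 1⁻¹)) :=
      (Real.continuousAt_log (by norm_num)).tendsto.comp (hlim.inv₀ one_ne_zero)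
    simp only [inv_one, Real.log_one] at h
    simpa only [hFdef, hinv] using h
  have hFtbot : Tendsto Ft atBot (𝓝 0) := by
    refine hFbot.congr' ?_
    filter_upwards [eventually_lt_atBot (0 : ℝ)] with z hz
    exact (Function.update_of_ne hz.ne _ _).symm
  -- limit at `0⁻`
  have hF0 : Tendsto F (𝓝[<] 0) (𝓝 (-Real.log d)) := by
    have hslope : Tendsto (fun x ↦ φ x / x) (𝓝[<] 0) (𝓝 d) :=
      (tendsto_div_nhds_zero hε hφ hφ0).mono_left (nhdsWithin_mono _ fun z hz ↦ (mem_Iio.1 hz).ne)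
    have h : Tendsto (fun x ↦ Real.log ((φ x / x)⁻¹)) (𝓝[<] 0) (𝓝 (Real.log d⁻¹)) :=
      (Real.continuousAt_log (inv_ne_zero hd0.ne')).tendsto.comp (hslope.inv₀ hd0.ne')
    rw [Real.log_inv] at h
    simpa only [hFdef, hinv] using h
  have hcont0 : ContinuousWithinAt Ft (Iic 0) 0 := by
    rw [hFtdef, continuousWithinAt_update_same, Iic_sdiff_right]
    exact hF0
  have hnn' : ∀ x ∈ Iic (0 : ℝ), 0 ≤ x⁻¹ - deriv φ x / φ x := by
    intro x hx
    rcases (mem_Iic.1 hx).eq_or_lt with rfl | hx'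
    · simp [hφ0]
    · exact hnn x hx'
  have hint : IntegrableOn (fun x ↦ x⁻¹ - deriv φ x / φ x) (Iic 0) :=
    integrableOn_Iic_deriv_of_nonneg hcont0 hderivFt hnn' hFtbot
  refine ⟨hint.mono_set Iio_subset_Iic_self, ?_⟩
  rw [← integral_Iic_eq_integral_Iio, integral_Iic_of_hasDerivAt_of_tendsto hcont0 hderivFt hint hFtbot]
  simp [hFtdef]

/-! ### The identity -/

/-- **The excursion-kernel identity, iterated real form**: under the hypotheses above and
`g ≥ 0` off the diagonal,
`∫_{−∞}^0 (∫_{−∞}^0 g(x, y) dy) dx = ∫_{−∞}^0 (1/x − φ'(x)/φ(x)) dx = −log φ'(0)`. [folklore] -/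
theorem integral_integral_excursionKernel (hε : 0 < ε) (hφ : ContDiffOn ℝ 2 φ (Iio ε)) (hφ0 : φ 0 = 0)
    (hpos : ∀ x, x < ε → 0 < deriv φ x) (hlim : Tendsto (fun x ↦ φ x / x) atBot (𝓝 1))
    (hg : ∀ x y, x < 0 → y < 0 → x ≠ y →
      0 ≤ ((x - y) ^ 2)⁻¹ - deriv φ x * deriv φ y / (φ x - φ y) ^ 2) :
    ∫ x in Iio 0, ∫ y in Iio 0, (((x - y) ^ 2)⁻¹ - deriv φ x * deriv φ y / (φ x - φ y) ^ 2) =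
      -Real.log (deriv φ 0) := by
  have hinner := fun x (hx : x < 0) ↦
    integral_Iio_excursionKernel hε hφ hφ0 hpos hlim hx fun y hy hyx ↦ hg x y hx hy (Ne.symm hyx)
  have hnn : ∀ x, x < 0 → 0 ≤ x⁻¹ - deriv φ x / φ x := by
    intro x hx
    rw [← (hinner x hx).2]
    refine setIntegral_nonneg measurableSet_Iio fun y hy ↦ ?_
    rcases eq_or_ne x y with rfl | hxy
    · simp
    · exact hg x y hx hy hxy
  rw [← (integral_Iio_inv_sub_deriv_div hε hφ hφ0 hpos hlim hnn).2]
  exact setIntegral_congr_fun measurableSet_Iio fun x hx ↦ (hinner x hx).2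

/-- **The excursion-kernel identity**: for `φ` of class `C²` on `(−∞, ε)` (`ε > 0`) with
`φ(0) = 0`, `φ' > 0`, `φ(x)/x → 1` at `−∞`, and
`g(x, y) = (x − y)⁻² − φ'(x)φ'(y)(φ(x) − φ(y))⁻² ≥ 0` off the diagonal,

  `∫⁻_{x<0} ∫⁻_{y<0} g(x, y) dy dx = −log φ'(0)`.

(For `φ` the boundary trace of the restriction map `Φ_A` of a hull `A` attached to `(0, ∞)`,
`g(x, y) dx dy` is the mass of Brownian excursions of `ℍ` from `x` to `y` hitting `A` under the
excursion measure `(x − y)⁻² dx dy ⊗ P^{x→y}`, and the identity computes the total mass of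
excursions between points of `(−∞, 0)` which hit `A`.) [folklore] -/
theorem lintegral_lintegral_excursionKernel (hε : 0 < ε) (hφ : ContDiffOn ℝ 2 φ (Iio ε)) (hφ0 : φ 0 = 0)
    (hpos : ∀ x, x < ε → 0 < deriv φ x) (hlim : Tendsto (fun x ↦ φ x / x) atBot (𝓝 1))
    (hg : ∀ x y, x < 0 → y < 0 → x ≠ y →
      0 ≤ ((x - y) ^ 2)⁻¹ - deriv φ x * deriv φ y / (φ x - φ y) ^ 2) :
    ∫⁻ x in Iio 0, ∫⁻ y in Iio 0, ENNReal.ofReal (((x - y) ^ 2)⁻¹ - deriv φ x * deriv φ y / (φ x - φ y) ^ 2) =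
      ENNReal.ofReal (-Real.log (deriv φ 0)) := by
  have hinner := fun x (hx : x < 0) ↦
    integral_Iio_excursionKernel hε hφ hφ0 hpos hlim hx fun y hy hyx ↦ hg x y hx hy (Ne.symm hyx)
  -- `g(x, ·) ≥ 0` everywhere on `(−∞, 0)` (on the diagonal it is `0⁻¹ − φ'(x)²/0 = 0`)
  have hg' : ∀ x, x < 0 → ∀ y, y < 0 → 0 ≤ ((x - y) ^ 2)⁻¹ - deriv φ x * deriv φ y / (φ x - φ y) ^ 2 := by
    intro x hx y hy
    rcases eq_or_ne x y with rfl | hxy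
    · simp
    · exact hg x y hx hy hxy
  have hnn : ∀ x, x < 0 → 0 ≤ x⁻¹ - deriv φ x / φ x := by
    intro x hx
    rw [← (hinner x hx).2]
    exact setIntegral_nonneg measurableSet_Iio fun y hy ↦ hg' x hx y hy
  have houter := integral_Iio_inv_sub_deriv_div hε hφ hφ0 hpos hlim hnn
  have h1 : ∫⁻ x in Iio 0, ∫⁻ y in Iio 0,
      ENNReal.ofReal (((x - y) ^ 2)⁻¹ - deriv φ x * deriv φ y / (φ x - φ y) ^ 2) =
        ∫⁻ x in Iio 0, ENNReal.ofReal (x⁻¹ - deriv φ x / φ x) := by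
    refine setLIntegral_congr_fun measurableSet_Iio fun x hx ↦ ?_
    rw [← (hinner x hx).2, ofReal_integral_eq_lintegral_ofReal (hinner x hx).1]
    exact (ae_restrict_iff' measurableSet_Iio).2 (ae_of_all _ fun y hy ↦ hg' x hx y hy)
  rw [h1, ← houter.2, ofReal_integral_eq_lintegral_ofReal houter.1]
  exact (ae_restrict_iff' measurableSet_Iio).2 (ae_of_all _ fun x hx ↦ hnn x hx)

/-- **The excursion-kernel identity on the product space**: with `φ` moreover measurable (as a
function on `ℝ`), `∫⁻_{(−∞,0)²} g d(x, y) = −log φ'(0)` for the Lebesgue measure of `ℝ²`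
(Tonelli). [folklore] -/
theorem setLIntegral_prod_excursionKernel (hε : 0 < ε) (hφ : ContDiffOn ℝ 2 φ (Iio ε)) (hφ0 : φ 0 = 0)
    (hpos : ∀ x, x < ε → 0 < deriv φ x) (hlim : Tendsto (fun x ↦ φ x / x) atBot (𝓝 1))
    (hmeas : Measurable φ)
    (hg : ∀ x y, x < 0 → y < 0 → x ≠ y →
      0 ≤ ((x - y) ^ 2)⁻¹ - deriv φ x * deriv φ y / (φ x - φ y) ^ 2) :
    ∫⁻ p in Iio (0 : ℝ) ×ˢ Iio (0 : ℝ),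
        ENNReal.ofReal (((p.1 - p.2) ^ 2)⁻¹ - deriv φ p.1 * deriv φ p.2 / (φ p.1 - φ p.2) ^ 2) =
      ENNReal.ofReal (-Real.log (deriv φ 0)) := by
  have hmg : Measurable fun p : ℝ × ℝ ↦
      ENNReal.ofReal (((p.1 - p.2) ^ 2)⁻¹ - deriv φ p.1 * deriv φ p.2 / (φ p.1 - φ p.2) ^ 2) := by
    have hd : Measurable (deriv φ) := measurable_deriv φ
    fun_prop
  rw [Measure.volume_eq_prod, ← Measure.prod_restrict, lintegral_prod _ hmg.aemeasurable]
  exact lintegral_lintegral_excursionKernel hε hφ hφ0 hpos hlim hg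

end ExcursionKernel

end Literature.Probability.RandomPlanarGeometry

end
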